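import Literature.AlgebraicTopology.Homotopy.SuspensionReflection
import HarnessLib

/-!
# Naturality of the Freudenthal suspension under suspended maps

Topic `Literature/AlgebraicTopology/Homotopy`. For the suspension homomorphism
`E = j_*⁻¹ ∘ incl_* ∘ ∂⁻¹ : π(Sⁿ) → π(Sⁿ⁺¹)` of the hemisphere triad (`FreudenthalSuspension.lean`,
Hatcher, *Algebraic Topology* (2002), Cor. 4.24 and its proof) and a self-map `Φ` of `Sⁿ⁺¹`
preserving the height (hence both hemispheres and the equator) — the suspension `S c` of a self-map
`c` of the equator `Sⁿ` — the three maps `∂`, `incl_*`, `j_*` are natural, whence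
`Φ_* ∘ E = E ∘ c_*` (Hatcher 2002, §4.1 p. 344, naturality of the sequence of a pair; the
functoriality of the suspension, G. W. Whitehead, *Elements of Homotopy Theory* (1978), Ch. XI):

* `Freudenthal.upMap`, `Freudenthal.eqMap` — the restrictions of a height-preserving `Φ` to the
  upper hemisphere and to the equator;
* `Freudenthal.triadSuspension_natural` — **`Φ_* (E y) = E ((Φ|Sⁿ)_* y)`** (base point fixed by
  `Φ`, induced maps along the base-point equation, `BasedMaps.lean`);
* `Freudenthal.suspension_natural` — the same for the metric spheres: if `Φ (x', 0) = (c x', 0)`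
  for a self-map `c` of `Sⁿ` fixing `x`, then `Φ_* (E z) = E (c_* z)` on `π_{m+1}(Sⁿ, x)`;
* `Freudenthal.homotopyGroupMapOfEq_refl_suspension` — the reflection formula
  `R_* (E z) = (E z)⁻¹` of `SuspensionReflection.lean` for the metric-sphere suspension.

Everything is proved; no named facts.

## References

* A. Hatcher, *Algebraic Topology*, CUP (2002), §4.1 p. 344, §4.2 Cor. 4.24 (proof, p. 360).
  [HatcherAT2002]
-/

noncomputable section

open Set Function Metric Topology unitInterval
open scoped Topology Topology.Homotopy
open Literature.AlgebraicTopology.SingularHomology.SphereComplement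

namespace Literature.AlgebraicTopology.Homotopy

namespace Freudenthal

open Hemi HemisphereExcision RelGenLoop

/-- Local notation: `𝔼 n` is the model Euclidean space `EuclideanSpace ℝ (Fin n)`. -/
local notation "𝔼 " n:arg => EuclideanSpace ℝ (Fin n)

/-- Local notation: `𝕊 n` is the unit sphere in `EuclideanSpace ℝ (Fin (n + 1))`. -/
local notation "𝕊 " n:arg => (Metric.sphere (0 : EuclideanSpace ℝ (Fin (n + 1))) 1)

variable {n : ℕ} {N : Type*} [Fintype N] [DecidableEq N]

/-! ### Restrictions of a height-preserving self-map -/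

section Restrict

variable (Φ : C(𝕊 (n + 1), 𝕊 (n + 1))) (hΦ : ∀ y, hgt (Φ y) = hgt y)

/-- The restriction of a height-preserving self-map of `Sⁿ⁺¹` to the closed upper hemisphere.
[folklore] -/
def upMap : C(Up n, Up n) :=
  ⟨fun x => ⟨Φ x.1, show 0 ≤ hgt (Φ x.1) by rw [hΦ]; exact x.2⟩,
    (Φ.continuous.comp continuous_subtype_val).subtype_mk _⟩

/-- `upMap` on points. [folklore] -/
@[simp]
theorem coe_upMap (x : Up n) : ((upMap Φ hΦ x : Up n) : 𝕊 (n + 1)) = Φ x := rfl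

/-- `upMap` preserves the equator. [folklore] -/
theorem mapsTo_upMap_eqUp : MapsTo (upMap Φ hΦ) (eqUp n) (eqUp n) := fun x hx => by
  have hx' : hgt x.1 = 0 := hx
  show hgt (Φ x.1) = 0
  rw [hΦ, hx']

include hΦ in
/-- A height-preserving self-map preserves the closed lower hemisphere. [folklore] -/
theorem mapsTo_capLo_of_hgt : MapsTo Φ (capLo : Set (𝕊 (n + 1))) capLo := fun x hx => by
  have hx' : hgt x ≤ 0 := hx
  show hgt (Φ x) ≤ 0
  rw [hΦ]; exact hx'

/-- `incl ∘ upMap = Φ ∘ incl`. [folklore] -/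
theorem incl_comp_upMap : (incl n).comp (upMap Φ hΦ) = Φ.comp (incl n) :=
  ContinuousMap.ext fun _ => rfl

/-- The restriction of a height-preserving self-map of `Sⁿ⁺¹` to the equator. [folklore] -/
def eqMap : C(↥(eqUp n), ↥(eqUp n)) :=
  ⟨fun x => ⟨upMap Φ hΦ x.1, mapsTo_upMap_eqUp Φ hΦ x.2⟩,
    ((upMap Φ hΦ).continuous.comp continuous_subtype_val).subtype_mk _⟩

/-- `eqMap` on points. [folklore] -/
@[simp]
theorem coe_eqMap (x : ↥(eqUp n)) : ((eqMap Φ hΦ x : ↥(eqUp n)) : Up n) = upMap Φ hΦ x := rfl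

end Restrict

/-! ### Naturality of `E` -/

section Triad

variable (s : N) (Φ : C(𝕊 (n + 1), 𝕊 (n + 1))) (hΦ : ∀ y, hgt (Φ y) = hgt y)

/-- **Naturality of the suspension homomorphism: `Φ_* (E y) = E ((Φ|Sⁿ)_* y)`** for a
height-preserving self-map `Φ` of `Sⁿ⁺¹` fixing the base point `a` of the equator (the three maps
`∂`, `incl_*`, `j_*` are natural). [cite: HatcherAT2002, §4.1 p. 344, §4.2 Cor. 4.24 (proof, p. 360)] -/
theorem triadSuspension_natural [Nonempty N] [Nonempty { j // j ≠ s }] (a : ↥(eqUp n))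
    (ha : a = eqMap Φ hΦ a) (y : HomotopyGroup { j // j ≠ s } ↥(eqUp n) a) :
    homotopyGroupMapOfEq (N := N) Φ
        (congrArg (fun z : ↥(eqUp n) => ((z : Up n) : 𝕊 (n + 1))) ha) (triadSuspension s a y) =
      triadSuspension s a (homotopyGroupMapOfEq (eqMap Φ hΦ) ha y) := by
  set hb : ((loBase a : ↥(capLo : Set (𝕊 (n + 1)))) : 𝕊 (n + 1)) = Φ (loBase a : ↥(capLo : Set (𝕊 (n + 1)))) :=
    congrArg (fun z : ↥(eqUp n) => ((z : Up n) : 𝕊 (n + 1))) ha with hb_def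
  set b := triadSuspension s a y with hbE
  set c : RelHomotopyGroup s (Up n) (eqUp n) a := (boundaryIso s a).symm y with hc_def
  have hcy : RelHomotopyGroup.boundary c = y := by
    rw [← coe_boundaryIso s a]; exact (boundaryIso s a).apply_symm_apply y
  have hjb : RelHomotopyGroup.ofAbsolute s b = RelHomotopyGroup.map (incl n) mapsTo_incl_eqUp c := by
    rw [hbE, ← hcy]; exact ofAbsolute_triadSuspension_boundary s a c
  -- the class `Φ_* c` with `∂ (Φ_* c) = (Φ|Sⁿ)_* y`
  have ha' : ((a : Up n) : Up n) = upMap Φ hΦ (a : Up n) := congrArg Subtype.val ha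
  let c' : RelHomotopyGroup s (Up n) (eqUp n) a :=
    RelHomotopyGroup.mapOfEq (upMap Φ hΦ) (mapsTo_upMap_eqUp Φ hΦ) ha' c
  have hc' : RelHomotopyGroup.boundary c' = homotopyGroupMapOfEq (eqMap Φ hΦ) ha y := by
    rw [← hcy]
    exact RelHomotopyGroup.boundary_mapOfEq (upMap Φ hΦ) (mapsTo_upMap_eqUp Φ hΦ) ha' (eqMap Φ hΦ)
      (fun _ => rfl) c
  rw [← hc']
  refine eq_triadSuspension_boundary s a c' _ ?_
  -- `j (Φ_* b) = Φ_* (j b) = Φ_* (incl_* c) = incl_* (Φ_* c)`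
  calc RelHomotopyGroup.ofAbsolute s (homotopyGroupMapOfEq Φ hb b)
      = RelHomotopyGroup.mapOfEq Φ (mapsTo_capLo_of_hgt Φ hΦ) hb (RelHomotopyGroup.ofAbsolute s b) :=
        (RelHomotopyGroup.mapOfEq_ofAbsolute Φ (mapsTo_capLo_of_hgt Φ hΦ) hb b).symm
    _ = RelHomotopyGroup.mapOfEq Φ (mapsTo_capLo_of_hgt Φ hΦ) hb (RelHomotopyGroup.map (incl n) mapsTo_incl_eqUp c) :=
        congrArg _ hjb
    _ = RelHomotopyGroup.mapOfEq (Φ.comp (incl n)) ((mapsTo_capLo_of_hgt Φ hΦ).comp mapsTo_incl_eqUp) hb c :=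
        RelHomotopyGroup.mapOfEq_map Φ _ (incl n) _ hb c
    _ = RelHomotopyGroup.mapOfEq ((incl n).comp (upMap Φ hΦ)) (mapsTo_incl_eqUp.comp (mapsTo_upMap_eqUp Φ hΦ)) hb c :=
        RelHomotopyGroup.mapOfEq_congr (incl_comp_upMap Φ hΦ).symm _ _ _ _ c
    _ = RelHomotopyGroup.mapOfEq (b := loBase a) (incl n) mapsTo_incl_eqUp rfl c' :=
        (RelHomotopyGroup.mapOfEq_mapOfEq (incl n) mapsTo_incl_eqUp rfl (upMap Φ hΦ)
          (mapsTo_upMap_eqUp Φ hΦ) ha' c).symm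
    _ = RelHomotopyGroup.map (incl n) mapsTo_incl_eqUp c' := by rw [RelHomotopyGroup.mapOfEq_rfl]

end Triad

/-! ### The metric spheres -/

section Metric

variable {m : ℕ}

/-- Reindexing commutes with induced maps along a base-point equation. [folklore] -/
theorem homotopyGroupCongr_homotopyGroupMapOfEq {M M' : Type*} {X Y : Type*} [TopologicalSpace X]
    [TopologicalSpace Y] {x : X} {y : Y} (e : M ≃ M') (f : C(X, Y)) (h : y = f x) (a : HomotopyGroup M X x) :
    homotopyGroupCongr e (homotopyGroupMapOfEq f h a) = homotopyGroupMapOfEq f h (homotopyGroupCongr e a) := by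
  subst h
  rw [homotopyGroupMapOfEq_rfl]
  exact homotopyGroupCongr_homotopyGroupMap e f a

variable (n)

/-- **Naturality of the Freudenthal suspension of the metric spheres**: for a height-preserving
self-map `Φ` of `Sⁿ⁺¹` with `Φ (x', 0) = (c x', 0)` for a self-map `c` of `Sⁿ` fixing `x`,
`Φ_* (E z) = E (c_* z)` on `π_{m+1}(Sⁿ, x)`. [cite: HatcherAT2002, §4.1 p. 344, §4.2 Cor. 4.24] -/
theorem suspension_natural (Φ : C(𝕊 (n + 1), 𝕊 (n + 1))) (hΦ : ∀ y, hgt (Φ y) = hgt y)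
    (c : C(𝕊 n, 𝕊 n)) (hΦc : ∀ x', Φ (equator x') = equator (c x')) (x : 𝕊 n) (hx : x = c x)
    (hb : liftBase n x = Φ (liftBase n x)) (z : π_ (m + 1) (𝕊 n) x) :
    homotopyGroupMapOfEq Φ hb (suspension n m x z) = suspension n m x (homotopyGroupMapOfEq c hx z) := by
  -- the base point of the equator is fixed by `Φ|Sⁿ`
  have ha : equatorHomeo n x = eqMap Φ hΦ (equatorHomeo n x) := by
    apply Subtype.ext; apply Subtype.ext
    show equator x = Φ (equator x)
    rw [hΦc, ← hx]
  have key := triadSuspension_natural (N := Fin (m + 2)) 0 Φ hΦ (equatorHomeo n x) ha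
    ((homotopyGroupCongrMulEquiv (faceIndexEquiv (m + 1)).symm).toMonoidHom
      ((homotopyGroupMulEquivOfHomeomorph (N := Fin (m + 1)) (equatorHomeo n) x) z))
  -- `(Φ|Sⁿ)_* ∘ (≅)_* = (≅)_* ∘ c_*` on `π(Sⁿ, x)`, `≅ : Sⁿ ≅ equator`
  have hcomm : homotopyGroupMapOfEq (N := Fin (m + 1)) (eqMap Φ hΦ) ha
        (homotopyGroupMap (N := Fin (m + 1)) (equatorHomeo n : C(𝕊 n, ↥(eqUp n))) x z) =
      homotopyGroupMap (N := Fin (m + 1)) (equatorHomeo n : C(𝕊 n, ↥(eqUp n))) x (homotopyGroupMapOfEq c hx z) := by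
    rw [← homotopyGroupMapOfEq_rfl, homotopyGroupMapOfEq_comp, homotopyGroupMapOfEq_comp]
    refine homotopyGroupMapOfEq_congr (ContinuousMap.ext fun x' => ?_) _ _ z
    apply Subtype.ext; apply Subtype.ext
    show Φ (equator x') = equator (c x')
    exact hΦc x'
  show homotopyGroupMapOfEq Φ hb (triadSuspension 0 (equatorHomeo n x)
      (homotopyGroupCongr (faceIndexEquiv (m + 1)).symm
        (homotopyGroupMap (N := Fin (m + 1)) (equatorHomeo n : C(𝕊 n, ↥(eqUp n))) x z))) =
    triadSuspension 0 (equatorHomeo n x)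
      (homotopyGroupCongr (faceIndexEquiv (m + 1)).symm
        (homotopyGroupMap (N := Fin (m + 1)) (equatorHomeo n : C(𝕊 n, ↥(eqUp n))) x (homotopyGroupMapOfEq c hx z)))
  rw [← hcomm, homotopyGroupCongr_homotopyGroupMapOfEq]
  exact key

/-- **The reflection formula for the metric spheres**: `R_* (E z) = (E z)⁻¹` on
`π_{m+1}(Sⁿ, x)`, `R` the reflection of `Sⁿ⁺¹` in the equatorial hyperplane.
[cite: HatcherAT2002, §4.2 Cor. 4.24 (proof, p. 360)] -/
theorem homotopyGroupMapOfEq_refl_suspension (x : 𝕊 n) (z : π_ (m + 1) (𝕊 n) x) :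
    homotopyGroupMapOfEq reflMap (refl_loBase (equatorHomeo n x)).symm (suspension n m x z) =
      (suspension n m x z)⁻¹ :=
  homotopyGroupMapOfEq_refl_triadSuspension (N := Fin (m + 2)) 0 (equatorHomeo n x) _

end Metric

end Freudenthal

end Literature.AlgebraicTopology.Homotopy

end
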